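import Summits.QuantumFields.BalabanUV.Beta.MultiscaleCombesThomasL2Cells

/-!
# `T4Continuum.ShellMeasureDecayRowsLevelOpCells` — ROW J3 «E6-SHAPE FOR A `levelOp`-SECTIONED OPERATOR»: the cell-to-cell blocks
# of the inverse of the MODEL multi-region averaged operator `levelOp` ([B9] (3.24) SHAPE), read as continuous ℂ-linear maps
# between ℓ²-FIBRES, satisfy LITERALLY the host rows' decay shape `‖k c b′‖ ≤ c𝒢·e^{−(δ𝒢·dis (pos c) (pos b′))}` with `c𝒢`,
# `δ𝒢` from `d, c, a, C, κ` and the largest cell side only — by `Beta/MultiscaleCombesThomasL2Cells` BY NAME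
(cell `pub-balaban`, sub-cell `t4`, spine estimate NE7c (node U5b); NE7c ROUND-2 crew `t4-ne7c-formalise-*`, unit
`b2b-balaban-t4-ne7c-formalise-leaf-02` gen 13; owner table `t4/b2b-balaban-t4-ne7c-p1/LEAVES-NE7c-P1.md` estimate-lane ROW **J3**
(R-ne7cp1-g37-7 (b): «ONE Support theorem whose CONCLUSION is literally OUR row shape `∀ c b′, ‖k V c b′‖ ≤ c·e^{−δ·dis (pos c) (pos b′)}`
between cell fibres, from `decay_dirInv_cov` + `…L2Cells`»); leaf-05-g12's MAP N-ne7cL05g12-1 §2 row E1∕E6 (α3) and J1 memo (D5)∕(D9);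
ADDITIVE — imports `Summits/QuantumFields/BalabanUV/Beta/MultiscaleCombesThomasL2Cells` (beta-an4 g43, p-landed; over beta-d4-p2's
`MultiscaleDecay` ∕ beta-d4-p3's `MultiscaleCombesThomasL2Real`) ONLY and touches NO host; [folklore]; 0 `def`, 0 `def … : Prop`, 0 sorry,
0 citation tags of Bałaban's.)

HONEST FRAMING.  Finite four-torus programme, rung (B)+1 only — NOT infinite volume, NOT a mass gap, NOT the Clay problem, NOT
summit progress.  NE7c (`T4IndicatorShell.ShellWeightBound`) is NOT PRINTED in [Balaban 1983–89] and NOT PROVED; «NE7c ⇐ the named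
binders» (trigger c3).  THIS FILE is a JUNCTION on the MODEL side: it shows that the TYPE of the END hosts' decay rows `hk𝒢 hkH hkH₁`
(census E6: `k V c b′ : ℭ →L[ℂ] 𝔄w`, `‖k V c b′‖ ≤ c·e^{−δ·dis (pos c) (pos b′)}`) is INHABITED, with level-count- and volume-free
constants, by the cell blocks of `(levelOp)⁻¹` when the letter spaces are read as the ℓ²-FIBRE `EuclideanSpace ℂ (UT N × Cp)`
(one common fibre for all cells: block = `1_{cell c} ∘ (levelOp)⁻¹_ℂ ∘ 1_{cell b′}`), `pos` = the cell corner, `dis` = the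
scale-adapted distance `sdist`.  It does NOT say: that Bałaban's `𝒢`, `H`, `H₁` ARE `levelOp`-type inverses (node O ∕ row J1's
dictionary), that the host's letter norms are ℓ² (leaf-05-g12 (D9): the u-tuple's carrier is the (98) weighted-SUP pair, so the
(α3) residual = the sup∕gradient members `Beta/MultiscaleSupMember` ∕ `MultiscaleGlobalMember` modulo `hreg` — NOT here), nor
anything about complexified backgrounds (`levelOp` is REAL; the block is its complexification).  The gap is the Beta END's own
hypothesis `hcoer` (E7's species via `MultiscaleCoerciveTorusCov`, not discharged here).  No END host is touched; census COUNT
unchanged; nothing of Bałaban's asserted, cited or discharged.  HONEST DEPENDENCY (cell): continuum YM on T⁴ ⇐ BetaPertH ∧ nine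
spine estimates (0/9 proved); BetaPertH ⇐ (D1) ∧ (D4) ∧ CAP+tail; G-an2-4 gates asym, D1 and NE2/3/4.

CONTENT.  §1 (generic, Mathlib only): a real linear map `G` on `X → ℝ` with the two-set ℓ² bound
`Σ_{p∈Xc}(G u)_p² ≤ B²·Σ_{q∈Xb}u_q²` for `u` supported in `Xb` gives the COMPLEXIFIED block
`Matrix.toEuclideanCLM ((of fun p q => [p ∈ Xc][q ∈ Xb]·(G e_q)_p).map ofReal) : EuclideanSpace ℂ X →L[ℂ] EuclideanSpace ℂ X` of
operator norm `≤ B` (`opNorm_block_le`; the complexification splits `‖Tw‖² = ‖M·Re w‖² + ‖M·Im w‖²`).  §2 (the junction): in the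
analytic setting of `MultiscaleCombesThomasL2Cells.real_cellNorm_levelOp_inverse_le` (torus `UT N`, fibre `Cp`, a disjoint covering
cube family with levels, isometric `Rm`∕`T`, weights `a ≥ 0`, profiles `ω` with print-size `hscale`, `|c| ≤ c_max`, cell-sum coercivity
`C`, rate `0 ≤ κ ≤ 1`, `μ₀ = C − 2d·c_max²κ² − a_max(e^{2dκ} − 1) > 0`) and a bound `S_{l_k} ≤ S_max` on the cell sides:
**`decayRow_levelOp_cells`** — for ALL cells `c b′`,
`‖block c b′‖ ≤ (e^{4dκ}·S_max²∕μ₀) · exp(−(κ · sdist (corner c) (corner b′)))` — LITERALLY the row shape with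
`c𝒢 := e^{4dκ}S_max²∕μ₀`, `δ𝒢 := κ`, `pos := corner`, `dis := sdist`; **`decayRow_levelOp_cells_cov`** — the same with the coercivity
SUPPLIED from the (3.35)-shape gauge datum `g hg ε hε hgauge hloss` by `Beta/MultiscaleCoerciveTorusCov.multiscale_coercive_torus_cov` (the
pattern of `MultiscaleDecay.decay_levelOp_cov`): hypotheses = E7-type located regularity + numbers.
-/

noncomputable section

open Finset
open scoped Matrix ComplexConjugate BigOperators

namespace Summit.QuantumFields.BalabanUV.T4Continuum.ShellMeasureDecayRowsLevelOpCells

/-! ## §1 The complexified two-set block of a real linear map on `EuclideanSpace ℂ X` -/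

section Complexify

variable {X : Type*} [Fintype X] [DecidableEq X]

/-- a real vector is the linear combination of the coordinate singles. [folklore] -/
theorem eq_sum_smul_single (u : X → ℝ) : u = ∑ q, u q • (Pi.single q (1 : ℝ) : X → ℝ) := by
  ext j
  simp only [Finset.sum_apply, Pi.smul_apply, Pi.single_apply, smul_eq_mul, mul_ite, mul_one, mul_zero,
    Finset.sum_ite_eq, Finset.mem_univ, if_true]

/-- the two-set block kernel `M p q = [p ∈ Xc][q ∈ Xb]·(G e_q)_p` of a real linear map acts as `x ↦ 1_{Xc}·G(1_{Xb}·x)`. [folklore] -/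
theorem mulVec_block_eq (G : (X → ℝ) →ₗ[ℝ] (X → ℝ)) (Xc Xb : Finset X) (x : X → ℝ) (p : X) :
    ((Matrix.of fun p q => if p ∈ Xc ∧ q ∈ Xb then G (Pi.single q 1) p else 0) *ᵥ x) p =
      if p ∈ Xc then G (fun q => if q ∈ Xb then x q else 0) p else 0 := by
  simp only [Matrix.mulVec, dotProduct, Matrix.of_apply]
  by_cases hp : p ∈ Xc
  · rw [if_pos hp]
    have hlin : G (fun q => if q ∈ Xb then x q else 0) =
        ∑ q, (if q ∈ Xb then x q else 0) • G (Pi.single q 1) := by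
      conv_lhs => rw [eq_sum_smul_single (fun q => if q ∈ Xb then x q else 0)]
      rw [map_sum]
      exact sum_congr rfl fun q _ => by rw [map_smul]
    rw [hlin, Finset.sum_apply]
    refine sum_congr rfl fun q _ => ?_
    simp only [hp, true_and, Pi.smul_apply, smul_eq_mul]
    split_ifs with hq
    · ring
    · simp
  · rw [if_neg hp]
    exact sum_eq_zero fun q _ => by simp [hp]

/-- **Norm of a complexified real matrix on `EuclideanSpace ℂ X`.**  If `Σ_p (M x)_p² ≤ B²·Σ_q x_q²` for all REAL `x` (`B ≥ 0`), then
`‖toEuclideanCLM (M.map ofReal)‖ ≤ B` (the complexification acts on real and imaginary parts separately: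
`‖Tw‖² = ‖M·Re w‖² + ‖M·Im w‖²`). [folklore] -/
theorem opNorm_toEuclideanCLM_map_ofReal_le (M : Matrix X X ℝ) {B : ℝ} (hB : 0 ≤ B)
    (hM : ∀ x : X → ℝ, ∑ p, (M *ᵥ x) p ^ 2 ≤ B ^ 2 * ∑ q, x q ^ 2) :
    ‖Matrix.toEuclideanCLM (n := X) (𝕜 := ℂ) (M.map Complex.ofReal)‖ ≤ B := by
  set T := Matrix.toEuclideanCLM (n := X) (𝕜 := ℂ) (M.map Complex.ofReal) with hT
  refine T.opNorm_le_bound hB fun w => ?_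
  refine (sq_le_sq₀ (by positivity) (by positivity)).mp ?_
  have hcoord : ∀ p, (T w) p = ∑ q, (M p q : ℂ) * w q := by
    intro p
    have e := congrFun (Matrix.ofLp_toEuclideanCLM (n := X) (𝕜 := ℂ) (M.map Complex.ofReal) w) p
    rw [hT]
    refine e.trans ?_
    simp only [Matrix.mulVec, dotProduct, Matrix.map_apply]
  have hre : ∀ p, ((T w) p).re = (M *ᵥ fun q => (w q).re) p := by
    intro p
    rw [hcoord p, Complex.re_sum]
    simp only [Matrix.mulVec, dotProduct, Complex.re_ofReal_mul]
  have him : ∀ p, ((T w) p).im = (M *ᵥ fun q => (w q).im) p := by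
    intro p
    rw [hcoord p, Complex.im_sum]
    simp only [Matrix.mulVec, dotProduct, Complex.im_ofReal_mul]
  have hnorm : ∀ p, ‖(T w) p‖ ^ 2 = (M *ᵥ fun q => (w q).re) p ^ 2 + (M *ᵥ fun q => (w q).im) p ^ 2 := by
    intro p
    rw [Complex.sq_norm, Complex.normSq_apply, hre p, him p]
    ring
  have hw2 : ‖w‖ ^ 2 = ∑ q, (w q).re ^ 2 + ∑ q, (w q).im ^ 2 := by
    rw [EuclideanSpace.norm_sq_eq, ← sum_add_distrib]
    refine sum_congr rfl fun q _ => ?_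
    rw [Complex.sq_norm, Complex.normSq_apply]; ring
  rw [EuclideanSpace.norm_sq_eq, mul_pow, hw2]
  simp_rw [hnorm]
  rw [sum_add_distrib, mul_add]
  exact add_le_add (hM _) (hM _)

/-- **The two-set block bound.**  A real linear map `G` with `Σ_{p∈Xc} (G u)_p² ≤ B²·Σ_{q∈Xb} u_q²` for every `u` supported in `Xb`
(`B ≥ 0`) gives a complexified block `1_{Xc} G_ℂ 1_{Xb}` of operator norm `≤ B` on `EuclideanSpace ℂ X`. [folklore] -/
theorem opNorm_block_le (G : (X → ℝ) →ₗ[ℝ] (X → ℝ)) (Xc Xb : Finset X) {B : ℝ} (hB : 0 ≤ B)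
    (hG : ∀ u : X → ℝ, (∀ q, q ∉ Xb → u q = 0) → ∑ p ∈ Xc, G u p ^ 2 ≤ B ^ 2 * ∑ q ∈ Xb, u q ^ 2) :
    ‖Matrix.toEuclideanCLM (n := X) (𝕜 := ℂ)
        ((Matrix.of fun p q => if p ∈ Xc ∧ q ∈ Xb then G (Pi.single q 1) p else 0).map Complex.ofReal)‖ ≤ B := by
  refine opNorm_toEuclideanCLM_map_ofReal_le _ hB fun x => ?_
  set u : X → ℝ := fun q => if q ∈ Xb then x q else 0 with hu
  have hu0 : ∀ q, q ∉ Xb → u q = 0 := fun q hq => by simp [hu, hq]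
  have h1 : ∑ p, ((Matrix.of fun p q => if p ∈ Xc ∧ q ∈ Xb then G (Pi.single q 1) p else 0) *ᵥ x) p ^ 2 =
      ∑ p ∈ Xc, G u p ^ 2 := by
    simp_rw [mulVec_block_eq G Xc Xb x]
    rw [← sum_filter_add_sum_filter_not univ (fun p => p ∈ Xc)]
    have hz : ∑ p ∈ univ.filter (fun p => ¬ p ∈ Xc), (if p ∈ Xc then G u p else 0) ^ 2 = 0 :=
      sum_eq_zero fun p hp => by rw [if_neg (mem_filter.mp hp).2]; ring
    rw [hz, add_zero]
    have hs : univ.filter (fun p => p ∈ Xc) = Xc := by ext p; simp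
    rw [hs]
    exact sum_congr rfl fun p hp => by rw [if_pos hp]
  have h2 : ∑ q ∈ Xb, u q ^ 2 ≤ ∑ q, x q ^ 2 := by
    calc ∑ q ∈ Xb, u q ^ 2 = ∑ q ∈ Xb, x q ^ 2 := sum_congr rfl fun q hq => by simp [hu, hq]
      _ ≤ ∑ q, x q ^ 2 := sum_le_univ_sum_of_nonneg fun q => sq_nonneg _
  rw [h1]
  exact (hG u hu0).trans (mul_le_mul_of_nonneg_left h2 (sq_nonneg B))

/-- From the square-root form `√(Σ_{Xc}(G u)²) ≤ B·√(Σ_{Xb}u²)` (the shape of `Beta/MultiscaleCombesThomasL2Cells`' END) to the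
squared form used by `opNorm_block_le`. [folklore] -/
theorem sq_form_of_sqrt_form {a b B : ℝ} (ha : 0 ≤ a) (h : Real.sqrt a ≤ B * Real.sqrt b) (hb : 0 ≤ b) :
    a ≤ B ^ 2 * b := by
  have h1 : Real.sqrt a ^ 2 ≤ (B * Real.sqrt b) ^ 2 := pow_le_pow_left₀ (Real.sqrt_nonneg _) h 2
  rw [Real.sq_sqrt ha, mul_pow, Real.sq_sqrt hb] at h1
  exact h1

end Complexify

/-! ## §2 The junction: cell blocks of `(levelOp)⁻¹` in the row shape of `hk𝒢` -/

section LevelOp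

open Summit.QuantumFields.BalabanUV.Beta
open Summit.QuantumFields.BalabanUV.Beta.BoxPoincare (Box)
open Summit.QuantumFields.BalabanUV.Beta.MultiscaleCoerciveTorus
open Summit.QuantumFields.BalabanUV.Beta.MultiscaleDistance
open Summit.QuantumFields.BalabanUV.Beta.MultiscaleDecayBudget
open Summit.QuantumFields.BalabanUV.Beta.MultiscaleCombesThomasL2Cells (real_cellNorm_levelOp_inverse_le)
open Summit.QuantumFields.BalabanUV.Beta.MultiscaleCoerciveTorusCov (multiscale_coercive_torus_cov)
open Summit.QuantumFields.BalabanUV.Beta.CovariantBoxPoincare (hol)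
open Literature.MathematicalPhysics.QuantumFieldTheory.Balaban1983to89
open Literature.MathematicalPhysics.QuantumFieldTheory.Balaban1983to89.B9Thm37GluePU (bsrc btgt)
open Literature.MathematicalPhysics.QuantumFieldTheory.Balaban1983to89.B9Thm37GlueTorusCov (tblk torusComb)
open Literature.MathematicalPhysics.QuantumFieldTheory.Balaban1983to89.B9Thm37GlueTorusCovLevels (levelOp)
open B5TorusCover (UT Ctr ctrU)

variable {d : ℕ} {N : Fin d → ℕ} [∀ i, NeZero (N i)] [NeZero d] {Cp J K : Type} [Fintype Cp] [DecidableEq Cp] [Nonempty Cp]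
  [Fintype J] [Fintype K] [DecidableEq K] (S : J → ℕ) (hS : ∀ l, 1 ≤ S l) (hdivS : ∀ l i, S l ∣ N i) (lvl : K → J)
  (zc : (k : K) → Ctr N (S (lvl k)))

/-! The analytic setting of `MultiscaleDecay.hc_levelOp` ∕ `MultiscaleCombesThomasL2Cells`, as section variables (verbatim). -/

variable
    (hdisj : ∀ k k' v v', cellPt S hS hdivS lvl zc k v = cellPt S hS hdivS lvl zc k' v' → k = k')
    (hcover : ∀ x : UT N, ∃ k, ∃ v : Box d (S (lvl k)), cellPt S hS hdivS lvl zc k v = x)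
    (Rm : UT N × Fin d → Cp → Cp → ℝ) (hRm : ∀ b i j, ∑ k, Rm b k i * Rm b k j = if i = j then (1 : ℝ) else 0)
    (T : J → UT N → Cp → Cp → ℝ) (hT : ∀ l x i i', ∑ k, T l x k i * T l x k i' = if i = i' then (1 : ℝ) else 0)
    (a : J → ℝ) (ha : ∀ j, 0 ≤ a j) (ω : J → UT N → ℝ)
    (hsupp : ∀ l x, ω l (ctrU N (S l) (tblk (hS l) (hdivS l) x)) ≠ 0 → ∃ k v, lvl k = l ∧ cellPt S hS hdivS lvl zc k v = x)
    {amax : ℝ} (hamax : 0 ≤ amax)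
    (hscale : ∀ k, a (lvl k) * ω (lvl k) (ctrU N (S (lvl k)) (zc k)) ^ 2 * (S (lvl k) : ℝ) ^ d ≤ amax / (S (lvl k) : ℝ) ^ 2)
    (c : UT N × Fin d → ℝ) {cmax : ℝ} (hc : ∀ b, |c b| ≤ cmax) {C : ℝ}
    (hcoer : ∀ f : UT N × Cp → ℝ,
      C * ∑ k, ((S (lvl k) : ℝ) ^ 2)⁻¹ * ∑ v : Box d (S (lvl k)), ∑ i, f (cellPt S hS hdivS lvl zc k v, i) ^ 2 ≤
        ∑ p, f p * levelOp bsrc btgt c Rm (fun l x => ctrU N (S l) (tblk (hS l) (hdivS l) x))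
          (fun l x => ω l (ctrU N (S l) (tblk (hS l) (hdivS l) x))) T a f p)
    {κ : ℝ} (hκ0 : 0 ≤ κ) (hκ1 : κ ≤ 1)

include hdisj hRm hT ha hsupp hamax hscale hc hcoer hκ0 hκ1

/-- **ROW J3 — THE DECAY-ROW SHAPE `‖k c b′‖ ≤ c𝒢·e^{−(δ𝒢·dis (pos c) (pos b′))}` INHABITED BY THE CELL BLOCKS OF `(levelOp)⁻¹` ON THE
ℓ²-FIBRE.**  In the setting of `MultiscaleCombesThomasL2Cells.real_cellNorm_levelOp_inverse_le`, with
`μ₀ = C − 2d·c_max²κ² − a_max(e^{2dκ} − 1) > 0` and cell sides `S_{l_k} ≤ S_max`, the COMPLEXIFIED cell block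
`k c b′ := toEuclideanCLM ((of fun p q => [cell p = c][cell q = b′]·((levelOp)⁻¹ e_q)_p).map ofReal) :
EuclideanSpace ℂ (UT N × Cp) →L[ℂ] EuclideanSpace ℂ (UT N × Cp)` satisfies, for ALL cells `c b′`:
`‖k c b′‖ ≤ (e^{4dκ}·S_max²∕μ₀) · exp(−(κ · sdist (corner c) (corner b′)))` — the host rows' shape with `c𝒢 := e^{4dκ}S_max²∕μ₀`
(level-count-, volume- and cell-cardinality-free), `δ𝒢 := κ`, `pos k := ctrU N (S (lvl k)) (zc k)`, `dis := sdist` (scale-adapted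
distance).  Proof: the Beta END's square-root cell-to-cell bound, squared, is §1's two-set hypothesis with
`B = e^{−κ(sdist − 4d)}∕√((μ₀S_c⁻²)(μ₀S_{b′}⁻²)) ≤ c𝒢·e^{−κ·sdist}`.  HONEST: ℓ²-fibre reading; `levelOp` is the MODEL operator,
real; the coercivity `hcoer` is a hypothesis of the END; nothing of Bałaban's. [folklore] -/
theorem decayRow_levelOp_cells (hμ : 0 < C - 2 * d * cmax ^ 2 * κ ^ 2 - amax * (Real.exp (2 * d * κ) - 1))
    {Smax : ℝ} (hSmax : ∀ k, (S (lvl k) : ℝ) ≤ Smax) (cc b' : K) :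
    ‖Matrix.toEuclideanCLM (n := UT N × Cp) (𝕜 := ℂ)
        ((Matrix.of fun p q : UT N × Cp =>
          if cellOf S hS hdivS lvl zc hcover p.1 = cc ∧ cellOf S hS hdivS lvl zc hcover q.1 = b' then
            (Ring.inverse (levelOp bsrc btgt c Rm (fun l x => ctrU N (S l) (tblk (hS l) (hdivS l) x))
              (fun l x => ω l (ctrU N (S l) (tblk (hS l) (hdivS l) x))) T a)) (Pi.single q 1) p
          else 0).map Complex.ofReal)‖ ≤
      (Real.exp (4 * d * κ) * Smax ^ 2 / (C - 2 * d * cmax ^ 2 * κ ^ 2 - amax * (Real.exp (2 * d * κ) - 1))) *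
        Real.exp (-(κ * sdist bsrc btgt (siteScale S hS hdivS lvl zc hcover) (ctrU N (S (lvl cc)) (zc cc))
          (ctrU N (S (lvl b')) (zc b')))) := by
  classical
  set μ₀ := C - 2 * d * cmax ^ 2 * κ ^ 2 - amax * (Real.exp (2 * d * κ) - 1) with hμ₀
  set G := Ring.inverse (levelOp bsrc btgt c Rm (fun l x => ctrU N (S l) (tblk (hS l) (hdivS l) x))
    (fun l x => ω l (ctrU N (S l) (tblk (hS l) (hdivS l) x))) T a) with hG
  set sd := sdist bsrc btgt (siteScale S hS hdivS lvl zc hcover) (ctrU N (S (lvl cc)) (zc cc))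
    (ctrU N (S (lvl b')) (zc b')) with hsd
  set Xc : Finset (UT N × Cp) := univ.filter (fun p => cellOf S hS hdivS lvl zc hcover p.1 = cc) with hXc
  set Xb : Finset (UT N × Cp) := univ.filter (fun p => cellOf S hS hdivS lvl zc hcover p.1 = b') with hXb
  -- positivity of the ingredients
  have hSpos : ∀ k, (0 : ℝ) < (S (lvl k) : ℝ) := fun k => by exact_mod_cast hS (lvl k)
  have hSmax0 : 0 < Smax := (hSpos cc).trans_le (hSmax cc)
  have hν : ∀ k, 0 < μ₀ * ((S (lvl k) : ℝ) ^ 2)⁻¹ := fun k => mul_pos hμ (inv_pos.mpr (pow_pos (hSpos k) 2))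
  -- the Beta END's constant and its uniform majorant
  set B : ℝ := Real.exp (-(κ * (sd - 2 * d - 2 * d))) /
      Real.sqrt (μ₀ * ((S (lvl cc) : ℝ) ^ 2)⁻¹ * (μ₀ * ((S (lvl b') : ℝ) ^ 2)⁻¹)) with hB
  have hden : 0 < Real.sqrt (μ₀ * ((S (lvl cc) : ℝ) ^ 2)⁻¹ * (μ₀ * ((S (lvl b') : ℝ) ^ 2)⁻¹)) :=
    Real.sqrt_pos.mpr (mul_pos (hν cc) (hν b'))
  have hB0 : 0 ≤ B := div_nonneg (Real.exp_pos _).le hden.le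
  -- the block bound from §1 + the Beta END
  have hblock : ‖Matrix.toEuclideanCLM (n := UT N × Cp) (𝕜 := ℂ)
      ((Matrix.of fun p q : UT N × Cp => if p ∈ Xc ∧ q ∈ Xb then G (Pi.single q 1) p else 0).map Complex.ofReal)‖ ≤ B := by
    refine opNorm_block_le G Xc Xb hB0 fun u hu => ?_
    have hu' : ∀ p : UT N × Cp, cellOf S hS hdivS lvl zc hcover p.1 ≠ b' → u p = 0 :=
      fun p hp => hu p (fun hmem => hp (mem_filter.mp hmem).2)
    have h := real_cellNorm_levelOp_inverse_le S hS hdivS lvl zc hdisj hcover Rm hRm T hT a ha ω hsupp hamax hscale c hc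
      hcoer hκ0 hκ1 hμ cc b' u hu'
    have h' : Real.sqrt (∑ p ∈ Xc, G u p ^ 2) ≤ B * Real.sqrt (∑ p ∈ Xb, u p ^ 2) := by
      rw [hB, hXc, hXb, hG]
      exact h
    exact sq_form_of_sqrt_form (sum_nonneg fun _ _ => sq_nonneg _) h' (sum_nonneg fun _ _ => sq_nonneg _)
  -- the two matrices agree
  have hmat : (Matrix.of fun p q : UT N × Cp =>
      if cellOf S hS hdivS lvl zc hcover p.1 = cc ∧ cellOf S hS hdivS lvl zc hcover q.1 = b' then G (Pi.single q 1) p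
      else 0) = (Matrix.of fun p q : UT N × Cp => if p ∈ Xc ∧ q ∈ Xb then G (Pi.single q 1) p else 0) := by
    ext p q
    simp only [Matrix.of_apply, hXc, hXb, mem_filter, mem_univ, true_and]
  rw [hmat]
  refine hblock.trans ?_
  -- `B ≤ c𝒢 · e^{−κ·sd}`
  have hexp : Real.exp (-(κ * (sd - 2 * d - 2 * d))) = Real.exp (4 * d * κ) * Real.exp (-(κ * sd)) := by
    rw [← Real.exp_add]; ring_nf
  have hsqrt_ge : μ₀ / Smax ^ 2 ≤ Real.sqrt (μ₀ * ((S (lvl cc) : ℝ) ^ 2)⁻¹ * (μ₀ * ((S (lvl b') : ℝ) ^ 2)⁻¹)) := by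
    have h1 : μ₀ / Smax ^ 2 ≤ μ₀ * ((S (lvl cc) : ℝ) ^ 2)⁻¹ := by
      rw [div_eq_mul_inv]
      exact mul_le_mul_of_nonneg_left (inv_anti₀ (pow_pos (hSpos cc) 2)
        (pow_le_pow_left₀ (hSpos cc).le (hSmax cc) 2)) hμ.le
    have h2 : μ₀ / Smax ^ 2 ≤ μ₀ * ((S (lvl b') : ℝ) ^ 2)⁻¹ := by
      rw [div_eq_mul_inv]
      exact mul_le_mul_of_nonneg_left (inv_anti₀ (pow_pos (hSpos b') 2)
        (pow_le_pow_left₀ (hSpos b').le (hSmax b') 2)) hμ.le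
    have h0 : 0 ≤ μ₀ / Smax ^ 2 := by positivity
    calc μ₀ / Smax ^ 2 = Real.sqrt ((μ₀ / Smax ^ 2) * (μ₀ / Smax ^ 2)) := (Real.sqrt_mul_self h0).symm
      _ ≤ Real.sqrt (μ₀ * ((S (lvl cc) : ℝ) ^ 2)⁻¹ * (μ₀ * ((S (lvl b') : ℝ) ^ 2)⁻¹)) :=
          Real.sqrt_le_sqrt (mul_le_mul h1 h2 h0 (hν cc).le)
  have hμS : 0 < μ₀ / Smax ^ 2 := by positivity
  calc B = Real.exp (4 * d * κ) * Real.exp (-(κ * sd)) /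
        Real.sqrt (μ₀ * ((S (lvl cc) : ℝ) ^ 2)⁻¹ * (μ₀ * ((S (lvl b') : ℝ) ^ 2)⁻¹)) := by rw [hB, hexp]
    _ ≤ Real.exp (4 * d * κ) * Real.exp (-(κ * sd)) / (μ₀ / Smax ^ 2) :=
        div_le_div_of_nonneg_left (by positivity) hμS hsqrt_ge
    _ = Real.exp (4 * d * κ) * Smax ^ 2 / μ₀ * Real.exp (-(κ * sd)) := by
        field_simp

omit hT hcoer in
/-- **ROW J3, COVARIANT FORM UNDER THE (3.35)-SHAPE GAUGE DATUM** (hypotheses = `hgauge`-type located regularity + numbers, as booked in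
R-ne7cp1-g37-7 (b)): with the contour transports of the cube combs as level transports and the cell-sum coercivity SUPPLIED by
`Beta/MultiscaleCoerciveTorusCov.multiscale_coercive_torus_cov` from a per-cell orthogonal box gauge `g` whose gauged in-cube bond variables
are `ε_k`-close to `1` (`hgauge`, loss budget `hloss … ≤ θ` — E7's species; S119 = J4 supplies it from plaquette-smallness), print-size
weights on both sides, `0 < c_min ≤ |c| ≤ c_max`, `0 ≤ κ ≤ 1`, `μ₀ = (1 − θ)·min(c_min²∕(4d), a_min∕4) − 2d·c_max²κ² − a_max(e^{2dκ} − 1) > 0`,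
`S_{l_k} ≤ S_max`: for ALL cells `c b′`, `‖block c b′‖ ≤ (e^{4dκ}S_max²∕μ₀)·exp(−(κ·sdist (corner c) (corner b′)))`.  = `decayRow_levelOp_cells`
∘ `multiscale_coercive_torus_cov` BY NAME (the pattern of `MultiscaleDecay.decay_levelOp_cov`). [folklore] -/
theorem decayRow_levelOp_cells_cov
    {amin : ℝ} (hamin : 0 ≤ amin)
    (hscale_lo : ∀ k, amin / (S (lvl k) : ℝ) ^ 2 ≤ a (lvl k) * ω (lvl k) (ctrU N (S (lvl k)) (zc k)) ^ 2 * (S (lvl k) : ℝ) ^ d)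
    {cmin : ℝ} (hcmin : 0 < cmin) (hc_lo : ∀ b, cmin ≤ |c b|)
    (g : (k : K) → Box d (S (lvl k)) → Cp → Cp → ℝ)
    (hg : ∀ k v i i', ∑ k', g k v k' i * g k v k' i' = if i = i' then (1 : ℝ) else 0) (ε : K → ℝ) (hε : ∀ k, 0 ≤ ε k)
    (hgauge : ∀ k (v : Box d (S (lvl k))) (i : Fin d) (hv : (v i : ℕ) + 1 < S (lvl k)) (u : Cp → ℝ),
      ∑ a', (∑ j, (hol Rm (g k) (fun v i _ => (cellPt S hS hdivS lvl zc k v, i)) v i hv a' j -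
        if a' = j then 1 else 0) * u j) ^ 2 ≤ ε k ^ 2 * ∑ j, u j ^ 2)
    {θ : ℝ} (hloss : ∀ k, 4 * ((d : ℝ) * (S (lvl k)) * ((S (lvl k) : ℝ) - 1)) * d * ε k ^ 2 +
      4 * ((d * (S (lvl k) - 1) : ℕ) * ε k) ^ 2 ≤ θ)
    (hμ : 0 < (1 - θ) * min (cmin ^ 2 / (4 * d)) (amin / 4) - 2 * d * cmax ^ 2 * κ ^ 2 - amax * (Real.exp (2 * d * κ) - 1))
    {Smax : ℝ} (hSmax : ∀ k, (S (lvl k) : ℝ) ≤ Smax) (cc b' : K) :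
    ‖Matrix.toEuclideanCLM (n := UT N × Cp) (𝕜 := ℂ)
        ((Matrix.of fun p q : UT N × Cp =>
          if cellOf S hS hdivS lvl zc hcover p.1 = cc ∧ cellOf S hS hdivS lvl zc hcover q.1 = b' then
            (Ring.inverse (levelOp bsrc btgt c Rm (fun l x => ctrU N (S l) (tblk (hS l) (hdivS l) x))
              (fun l x => ω l (ctrU N (S l) (tblk (hS l) (hdivS l) x))) (fun l x => (torusComb (hS l) (hdivS l)).tr Rm x) a))
              (Pi.single q 1) p
          else 0).map Complex.ofReal)‖ ≤
      (Real.exp (4 * d * κ) * Smax ^ 2 /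
          ((1 - θ) * min (cmin ^ 2 / (4 * d)) (amin / 4) - 2 * d * cmax ^ 2 * κ ^ 2 - amax * (Real.exp (2 * d * κ) - 1))) *
        Real.exp (-(κ * sdist bsrc btgt (siteScale S hS hdivS lvl zc hcover) (ctrU N (S (lvl cc)) (zc cc))
          (ctrU N (S (lvl b')) (zc b')))) :=
  decayRow_levelOp_cells S hS hdivS lvl zc hdisj hcover Rm hRm (fun l x => (torusComb (hS l) (hdivS l)).tr Rm x)
    (fun l x i i' => (torusComb (hS l) (hdivS l)).tr_orth Rm hRm x i i') a ha ω hsupp hamax hscale c hc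
    (fun f => multiscale_coercive_torus_cov (Nat.one_le_iff_ne_zero.mpr (NeZero.ne d)) S hS hdivS Rm hRm a ha ω c hcmin hc_lo lvl zc
      hdisj hamin hscale_lo g hg ε hε hgauge hloss f)
    hκ0 hκ1 hμ hSmax cc b'

end LevelOp

end Summit.QuantumFields.BalabanUV.T4Continuum.ShellMeasureDecayRowsLevelOpCells

end
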